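import Literature.NumberTheory.DiophantineGeometry.ShuteFourSquarefulXColour

/-!
# Shute (2021), §3: Proposition 3.2 for boxes with `Xᵢ³ ≤ Yᵢ²`

Sixth companion to `ShuteFourSquareful.lean` (named fact `Shute2021_prop32` = Shute's Prop. 3.2,
recorded as a CLAIM: the printed proof of the fourth-moment bound behind it is incomplete, see the
module docstring of `ShuteFourSquareful.lean`, section Status), after
`ShuteFourSquarefulHolder.lean` (Hölder: `N(𝐗, 𝐘)⁴ ≤ ∏ᵢ N(Xᵢ, Yᵢ)`),
`ShuteFourSquarefulMoment.lean` (`N(X, Y) ≪_ε X^{2+ε}Y^{3+ε}`) and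
`ShuteFourSquarefulXColour.lean` (`N(X, Y) ≪_ε X^{3+ε}Y^{2+ε}`, hence the printed
`N(X, Y) ≪_ε X^{2+ε}Y^{8/3+ε}` in the regime `X³ ≤ Y²`: `Shute2021.fourthMoment_le_of_cube_le_sq`).

We record the consequences of the last bound in the shape in which Prop. 3.2 and the route
`ABC/ExceptionalSetEnergy` consume the fourth moment, all PROVED:

* `Shute2021.quadricCount_le_of_fourthMoment_le_on`: the Hölder reduction of
  `ShuteFourSquarefulHolder.lean` restricted to a range `R` of box sizes (if
  `N(X, Y) ≤ C_ε X^{2+ε}Y^{θ+ε}` whenever `R X Y`, then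
  `N(𝐗, 𝐘) ≤ C'_ε (∏Xᵢ)^{1/2+ε} (∏Yᵢ)^{θ/4+ε}` for all boxes with `R Xᵢ Yᵢ` for every `i`);
* `Shute2021.quadricCount_le_twoThirds_of_pow_le`: **Prop. 3.2 holds for all boxes with
  `Xᵢ³ ≤ Yᵢ²` (`i = 1, …, 4`)**: `N(𝐗, 𝐘) ≤ C_ε (X₁X₂X₃X₄)^{1/2+ε} (Y₁Y₂Y₃Y₄)^{2/3+ε}` — the
  statement of `Shute2021_prop32` verbatim, under the side condition; in the paper's deduction of
  Prop. 3.1 (`Xᵢ = (B/Rᵢ³)^{1/2}`, `Yᵢ = 2Rᵢ`) these are the dyadic ranges with all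
  `Rᵢ ≥ (B/4)^{3/13}… ` i.e. `B³ ≤ 2⁶ Rᵢ¹³`;
* `Shute2021.addEnergy_squarefulShape_le_eightThirds_of_pow_le`: `E[S(X,Y), S(X,Y)] ≤
  C_ε (XY)^ε X² Y^{8/3}` for the squareful shape `S(X, Y) = {x²y³}` whenever `X³ ≤ Y²` (the
  conclusion of `Shute2021_prop32.addEnergy_squarefulShape_le`, unconditionally in this range);
* `Shute2021.fourthMoment_le_eightThirds_mul_loss`: for ALL `X, Y ≥ 1`,
  `N(X, Y) ≤ C_ε X^{2+ε} Y^{8/3+ε} · max(1, min(X, Y)/Y^{2/3})` — the printed bound up to the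
  explicit loss factor `max(1, min(X, Y) Y^{-2/3})`, which is `1` exactly when `X ≤ Y^{2/3}` and at
  most `Y^{1/3}` always.

## References

* A. Shute, *Sums of four squareful numbers*, arXiv:2104.06966 (2021), §3: Prop. 3.2, its proof
  (Hölder; "(the old prop)" `N(X, Y) = O(X^{2+ε}Y^{8/3+ε})`), and the deduction of Prop. 3.1
  (`M₁(B; 𝐑) ≤ N((B/Rᵢ³)^{1/2}, (2Rᵢ))`). [Shute2021]
-/

noncomputable section

open Finset

namespace Literature.NumberTheory.DiophantineGeometry

namespace Shute2021

/-! ### Hölder in a range of box sizes -/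

section RangeHolder

/-- **Hölder reduction restricted to a range** (variant of `quadricCount_le_of_fourthMoment_le`
with a side condition `R` on the box sizes): if `N(X, Y) ≤ C_ε X^{2+ε} Y^{θ+ε}` for all
`X, Y ≥ 1` with `R X Y`, then `N(𝐗, 𝐘) ≤ C'_ε (X₁X₂X₃X₄)^{1/2+ε} (Y₁Y₂Y₃Y₄)^{θ/4+ε}` for all boxes
with `R Xᵢ Yᵢ` for every `i`. [cite: Shute2021, §3, proof of Prop. 3.2 (Hölder step)] -/
theorem quadricCount_le_of_fourthMoment_le_on {θ : ℝ} (R : ℕ → ℕ → Prop)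
    (h : ∀ ε : ℝ, 0 < ε → ∃ C : ℝ, 0 < C ∧ ∀ X Y : ℕ, 1 ≤ X → 1 ≤ Y → R X Y →
      (fourthMoment X Y : ℝ) ≤ C * (X : ℝ) ^ (2 + ε) * (Y : ℝ) ^ (θ + ε)) :
    ∀ ε : ℝ, 0 < ε → ∃ C : ℝ, 0 < C ∧ ∀ X Y : Fin 4 → ℕ, (∀ i, 1 ≤ X i) → (∀ i, 1 ≤ Y i) →
      (∀ i, R (X i) (Y i)) →
      (quadricCount X Y : ℝ) ≤
        C * (∏ i, (X i : ℝ)) ^ (1 / 2 + ε) * (∏ i, (Y i : ℝ)) ^ (θ / 4 + ε) := by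
  intro ε hε
  obtain ⟨C, hC, hN⟩ := h (4 * ε) (by positivity)
  refine ⟨C, hC, fun X Y hX hY hR => ?_⟩
  have h4 : (quadricCount X Y : ℝ) ^ 4 ≤ ∏ i, (fourthMoment (X i) (Y i) : ℝ) := by
    exact_mod_cast quadricCount_pow_four_le X Y
  have hprod : ∏ i, (fourthMoment (X i) (Y i) : ℝ) ≤
      ∏ i, (C * (X i : ℝ) ^ (2 + 4 * ε) * (Y i : ℝ) ^ (θ + 4 * ε)) :=
    prod_le_prod (fun i _ => by positivity) fun i _ => hN _ _ (hX i) (hY i) (hR i)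
  have hsplit : ∏ i, (C * (X i : ℝ) ^ (2 + 4 * ε) * (Y i : ℝ) ^ (θ + 4 * ε)) =
      C ^ 4 * (∏ i, (X i : ℝ)) ^ (2 + 4 * ε) * (∏ i, (Y i : ℝ)) ^ (θ + 4 * ε) := by
    rw [prod_mul_distrib, prod_mul_distrib, prod_const, card_univ, Fintype.card_fin,
      Real.finsetProd_rpow _ _ (fun i _ => by positivity),
      Real.finsetProd_rpow _ _ (fun i _ => by positivity)]
  have key := le_rpow_inv_four_of_pow_four_le (by positivity) ((h4.trans hprod).trans_eq hsplit)
  rw [rpow_inv_four_prod hC.le (by positivity) (by positivity)] at key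
  convert key using 3 <;> ring

/-- **Prop. 3.2 in the range `Xᵢ³ ≤ Yᵢ²`**: for every `ε > 0` there is `C > 0` such that
`N(𝐗, 𝐘) ≤ C (X₁X₂X₃X₄)^{1/2+ε} (Y₁Y₂Y₃Y₄)^{2/3+ε}` for all boxes with `Xᵢ, Yᵢ ≥ 1` and
`Xᵢ³ ≤ Yᵢ²` for every `i` — the statement of `Shute2021_prop32` restricted to these boxes
(Hölder + `fourthMoment_le_of_cube_le_sq`). The unrestricted statement is Shute's Prop. 3.2,
whose printed proof is incomplete in the complementary regime. [cite: Shute2021, §3, Prop. 3.2] -/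
theorem quadricCount_le_twoThirds_of_pow_le :
    ∀ ε : ℝ, 0 < ε → ∃ C : ℝ, 0 < C ∧ ∀ X Y : Fin 4 → ℕ, (∀ i, 1 ≤ X i) → (∀ i, 1 ≤ Y i) →
      (∀ i, X i ^ 3 ≤ Y i ^ 2) →
      (quadricCount X Y : ℝ) ≤
        C * (∏ i, (X i : ℝ)) ^ (1 / 2 + ε) * (∏ i, (Y i : ℝ)) ^ (2 / 3 + ε) := by
  intro ε hε
  obtain ⟨C, hC, H⟩ := quadricCount_le_of_fourthMoment_le_on (θ := 8 / 3)
    (fun X Y => X ^ 3 ≤ Y ^ 2) fourthMoment_le_of_cube_le_sq ε hε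
  refine ⟨C, hC, fun X Y hX hY hR => ?_⟩
  have := H X Y hX hY hR
  norm_num at this
  exact this

end RangeHolder

/-! ### The additive energy in the range `X³ ≤ Y²`, and the loss factor in general -/

section EnergyRange

/-- **Additive energy of the squareful shape in the range `X³ ≤ Y²`**: for
`S = S(X, Y) = {x²y³ : 1 ≤ x ≤ X, 1 ≤ y ≤ Y, y square-free}` (`Shute2021.squarefulShape`),
`E[S, S] ≤ C_ε (XY)^ε X² Y^{8/3}` whenever `X³ ≤ Y²` — the conclusion of
`Shute2021_prop32.addEnergy_squarefulShape_le`, unconditionally in this range. [folklore] -/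
theorem addEnergy_squarefulShape_le_eightThirds_of_pow_le :
    ∀ ε : ℝ, 0 < ε → ∃ C : ℝ, 0 < C ∧ ∀ X Y : ℕ, 1 ≤ X → 1 ≤ Y → X ^ 3 ≤ Y ^ 2 →
      (Finset.addEnergy (squarefulShape X Y) (squarefulShape X Y) : ℝ) ≤
        C * ((X : ℝ) * Y) ^ ε * (X : ℝ) ^ 2 * (Y : ℝ) ^ (8 / 3 : ℝ) := by
  intro ε hε
  obtain ⟨C, hC, hN⟩ := fourthMoment_le_of_cube_le_sq ε hε
  refine ⟨C, hC, fun X Y hX hY hXY => ?_⟩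
  have hX0 : (0 : ℝ) < X := by exact_mod_cast hX
  have hY0 : (0 : ℝ) < Y := by exact_mod_cast hY
  calc (Finset.addEnergy (squarefulShape X Y) (squarefulShape X Y) : ℝ)
      ≤ fourthMoment X Y := by exact_mod_cast addEnergy_squarefulShape_le_fourthMoment X Y
    _ ≤ C * (X : ℝ) ^ (2 + ε) * (Y : ℝ) ^ (8 / 3 + ε) := hN X Y hX hY hXY
    _ = C * ((X : ℝ) * Y) ^ ε * (X : ℝ) ^ 2 * (Y : ℝ) ^ (8 / 3 : ℝ) := by
        rw [Real.rpow_add hX0, Real.rpow_add hY0, Real.mul_rpow hX0.le hY0.le,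
          show ((2 : ℝ)) = ((2 : ℕ) : ℝ) by norm_num, Real.rpow_natCast]
        ring

/-- Monotone form for sub-shapes (dyadic pieces `y ~ R` with `Y = 2R`): for every `T ⊆ S(X, Y)`
with `X³ ≤ Y²`, `E[T, T] ≤ C_ε (XY)^ε X² Y^{8/3}`. [folklore] -/
theorem addEnergy_le_eightThirds_of_subset_of_pow_le :
    ∀ ε : ℝ, 0 < ε → ∃ C : ℝ, 0 < C ∧ ∀ X Y : ℕ, 1 ≤ X → 1 ≤ Y → X ^ 3 ≤ Y ^ 2 →
      ∀ T : Finset ℕ, T ⊆ squarefulShape X Y →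
        (Finset.addEnergy T T : ℝ) ≤ C * ((X : ℝ) * Y) ^ ε * (X : ℝ) ^ 2 * (Y : ℝ) ^ (8 / 3 : ℝ) := by
  intro ε hε
  obtain ⟨C, hC, hE⟩ := addEnergy_squarefulShape_le_eightThirds_of_pow_le ε hε
  refine ⟨C, hC, fun X Y hX hY hXY T hT => le_trans ?_ (hE X Y hX hY hXY)⟩
  exact_mod_cast Finset.addEnergy_mono hT hT

/-- **The printed fourth-moment bound up to an explicit loss factor**: for all `X, Y ≥ 1`,
`N(X, Y) ≤ C_ε X^{2+ε} Y^{8/3+ε} · max(1, min(X, Y) / Y^{2/3})` (from `fourthMoment_le_min`); the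
loss factor is `1` exactly in the range `X ≤ Y^{2/3}` and is at most `Y^{1/3}` in general.
[folklore] -/
theorem fourthMoment_le_eightThirds_mul_loss :
    ∀ ε : ℝ, 0 < ε → ∃ C : ℝ, 0 < C ∧ ∀ X Y : ℕ, 1 ≤ X → 1 ≤ Y →
      (fourthMoment X Y : ℝ) ≤ C * (X : ℝ) ^ (2 + ε) * (Y : ℝ) ^ (8 / 3 + ε) *
        max 1 (min (X : ℝ) Y / (Y : ℝ) ^ (2 / 3 : ℝ)) := by
  intro ε hε
  obtain ⟨C, hC, hN⟩ := fourthMoment_le_min ε hε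
  refine ⟨C, hC, fun X Y hX hY => ?_⟩
  have hY0 : (0 : ℝ) < Y := by exact_mod_cast hY
  have hY23 : (0 : ℝ) < (Y : ℝ) ^ (2 / 3 : ℝ) := Real.rpow_pos_of_pos hY0 _
  have hmin : ((min X Y : ℕ) : ℝ) = min (X : ℝ) Y := Nat.cast_min X Y
  have hy : (Y : ℝ) ^ (8 / 3 + ε) = (Y : ℝ) ^ (2 + ε) * (Y : ℝ) ^ (2 / 3 : ℝ) := by
    rw [← Real.rpow_add hY0]
    congr 1
    ring
  calc (fourthMoment X Y : ℝ) ≤ C * (X : ℝ) ^ (2 + ε) * (Y : ℝ) ^ (2 + ε) * ((min X Y : ℕ) : ℝ) :=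
        hN X Y hX hY
    _ = C * (X : ℝ) ^ (2 + ε) * (Y : ℝ) ^ (8 / 3 + ε) * (min (X : ℝ) Y / (Y : ℝ) ^ (2 / 3 : ℝ)) := by
        rw [hy, hmin]
        field_simp
    _ ≤ C * (X : ℝ) ^ (2 + ε) * (Y : ℝ) ^ (8 / 3 + ε) *
          max 1 (min (X : ℝ) Y / (Y : ℝ) ^ (2 / 3 : ℝ)) := by
        gcongr
        exact le_max_right _ _

/-- The loss factor is at most `Y^{1/3}`: `max(1, min(X, Y)/Y^{2/3}) ≤ Y^{1/3}` for `Y ≥ 1`, so that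
`fourthMoment_le_eightThirds_mul_loss` contains `fourthMoment_le_three` up to the constant.
[folklore] -/
theorem loss_le_rpow_third {X Y : ℝ} (hY : 1 ≤ Y) :
    max 1 (min X Y / Y ^ (2 / 3 : ℝ)) ≤ Y ^ (1 / 3 : ℝ) := by
  have hY0 : 0 < Y := by linarith
  have hY23 : 0 < Y ^ (2 / 3 : ℝ) := Real.rpow_pos_of_pos hY0 _
  refine max_le (Real.one_le_rpow hY (by norm_num)) ?_
  have h1 : (1 / 3 : ℝ) + 2 / 3 = 1 := by norm_num
  rw [div_le_iff₀ hY23, ← Real.rpow_add hY0, h1, Real.rpow_one]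
  exact min_le_right _ _

end EnergyRange

end Shute2021

end Literature.NumberTheory.DiophantineGeometry
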